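import Literature.NumberTheory.BeurlingPrimes.BDRTemplateStieltjes
import Literature.NumberTheory.BeurlingPrimes.BDRRiemannCount
import Literature.NumberTheory.BeurlingPrimes.BVPerron
import Literature.NumberTheory.BeurlingPrimes.LogZetaMellin
import HarnessLib

/-!
# BDR 2023, Theorem 3.2: `ζ_𝒫(s) = E_M(s) e^{Z(s)}` with `Z` holomorphic on `Re s > 0` and the bound (3.4)

Topic `Literature/NumberTheory/BeurlingPrimes`, grouping namespace `BDR`. Everything in this file is PROVED.

Broucke–Debruyne–Révész (2023), proof of Theorem 3.2: "the error `Z(s) := ℳ{dΠ_𝒫 − dG; s}` here arises as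
the Mellin–Stieltjes transform of the error function `Π_𝒫(x) − G(x)`, which is `O(log log x)`. Hence `Z(s)` is
analytic for `Re s > 0`. Recalling the definition (3.3) of `E(s)`, we have `E(s) = exp(ℳ{dG; s})`, so that
`ζ_𝒫(s) = E(s)e^{Z(s)}`. … to deduce the asymptotic behavior of `N_𝒫(x)` we need the bound (3.4) for `Z(s)`. …
`Z(s) = ℳ{dΠ_𝒫 − dπ_𝒫; s} + ℳ{dπ_𝒫 − dF; s} − ℳ{dG − dF; s}`" with the middle term bounded through `J(x,t)`
by partial integration in `x` for fixed `t`.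

Here, for admissible data `h : Adm R S δ M` (`BDRTemplate.lean`), a system `P` with `|π_P − F| ≤ A'` and the
Broucke–Vindas approximation `BV.Approx f P A` ((1.3) for the template density `f = F′`):

* `E R S δ M s = s/(s−1) ∏_{ω∈S} s/(s−ω) ∏_{ρ∈R} (s−ρ)/s (s/(s−δ))^M` and
  **`Z h P s = s ∫₁^∞ (Π_P(x) − G(x)) x^{−s−1} dx`** (`= ℳ{dΠ_𝒫 − dG; s}` after integration by parts);
* `Adm.differentiableOn_Z` — `Z` is holomorphic on `Re s > 0` (a Mellin transform of `O(log log x)`); `Z(σ) ∈ ℝ`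
  for real `σ` (`Adm.Z_ofReal_im`);
* `Adm.exp_integral_g_cpow` — `exp ∫₁^∞ g(u) u^{−s} du = E(s)` (`g = G′ = Σ cpowDensity`, tree
  `exp_integral_cpowDensity_mul_cpow`), `Adm.integral_g_cpow_eq` — `∫₁^∞ g u^{−s} = s∫₁^∞ G x^{−s−1}` and
  **`Adm.zeta_eq_E_mul_exp_Z`** — `ζ_P(s) = E(s) e^{Z(s)}` for `Re s > 1` (tree `LogZetaMellin`);
* `Adm.Z_eq_bvZ` — on `Re s > 1/2`, `Z` coincides with the tree's Broucke–Vindas continuation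
  `BV.Z fT g P = E₁ + E₂ − E₃` for the truncated density `fT` (`BDRTemplateStieltjes.lean`; both are holomorphic
  there and agree on `Re s > 1`), whence **the bound (3.4)** `Adm.norm_Z_le`:
  `‖Z(σ+it)‖ ≤ K(σ/(σ−1/2) + σ√(log(|t|+1)/(σ−1/2)))` for all `σ > 1/2` (BV's (3.2) on `σ ≤ 2`, and the three
  pieces separately on `σ ≥ 2`).

## References
* [BrouckeDebruyneRevesz2023] F. Broucke, G. Debruyne, Sz. Gy. Révész, *Some examples of well-behaved Beurling
  number systems*, arXiv:2309.01567, Theorem 3.2 and its proof ((3.3), (3.4), the decomposition of `Z`) (read,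
  pp. 7–9).
* [BrouckeVindas2024] F. Broucke, J. Vindas, Math. Z. 307 (2024), arXiv:2102.08478, proof of Theorem 3.1 (3.2).
-/

noncomputable section

open Complex Set Filter MeasureTheory Real Asymptotics
open scoped Topology Nat

namespace Literature.NumberTheory.BeurlingPrimes

open Literature.Barriers.RiemannHypothesis

namespace BDR

/-! ### `E_M` and `Z` -/

/-- **`E(s) = E_M(s) = s/(s−1) ∏_{ω∈S} s/(s−ω) ∏_{ρ∈R} (s−ρ)/s (s/(s−δ))^M`** (BDR (3.3)), in the shape of the
tree's named fact `BrouckeDebruyneRevesz2023_thm32`. [cite: BrouckeDebruyneRevesz2023, Theorem 3.2 (3.3)] -/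
def E (R S : Finset ℝ) (δ : ℝ) (M : ℕ) (s : ℂ) : ℂ :=
  s / (s - 1) * (∏ ω ∈ S, s / (s - ω)) * (∏ ρ ∈ R, (s - ρ) / s) * (s / (s - δ)) ^ M

variable {R S : Finset ℝ} {δ : ℝ} {M : ℕ}

/-- The error `Π_P(x) − G(x)` as a complex number (it vanishes for `x < 1`). [cite: BrouckeDebruyneRevesz2023, proof of Theorem 3.2] -/
def piErr (R S : Finset ℝ) (δ : ℝ) (M : ℕ) (P : BeurlingPrimes) (x : ℝ) : ℂ :=
  ((P.riemannPrimeCount x - G R S δ M x : ℝ) : ℂ)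

/-- **`Z(s) = s ∫₁^∞ (Π_P(x) − G(x)) x^{−s−1} dx`** (`= ℳ{dΠ_𝒫 − dG; s}`).
[cite: BrouckeDebruyneRevesz2023, proof of Theorem 3.2] -/
def Z (R S : Finset ℝ) (δ : ℝ) (M : ℕ) (P : BeurlingPrimes) (s : ℂ) : ℂ :=
  s * ∫ x in Ioi (1 : ℝ), piErr R S δ M P x * (x : ℂ) ^ (-s - 1)

variable (h : Adm R S δ M) (P : BeurlingPrimes)
include h

/-! ### `Z` is holomorphic on `Re s > 0` -/

omit h in
/-- `piErr` vanishes on `(−∞, 1)`. [folklore] -/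
theorem piErr_eq_zero_of_lt_one {x : ℝ} (hx : x < 1) : piErr R S δ M P x = 0 := by
  rw [piErr, P.riemannPrimeCount_eq_zero_of_lt_one hx, G_eq_zero_of_le_one hx.le, sub_zero, Complex.ofReal_zero]

/-- `piErr` is measurable. [folklore] -/
theorem Adm.measurable_piErr : Measurable (piErr R S δ M P) :=
  Complex.measurable_ofReal.comp (P.measurable_riemannPrimeCount.sub h.continuous_G.measurable)

/-- A local bound: `‖piErr x‖ ≤ Π_P(X) + G(X)` for `x ≤ X`. [folklore] -/
theorem Adm.norm_piErr_le {x X : ℝ} (hxX : x ≤ X) : ‖piErr R S δ M P x‖ ≤ P.riemannPrimeCount X + G R S δ M X := by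
  rw [piErr, Complex.norm_real, Real.norm_eq_abs, abs_le]
  have := P.riemannPrimeCount_nonneg x
  have := P.riemannPrimeCount_mono hxX
  have := h.G_nonneg x
  have := h.G_mono hxX
  constructor <;> linarith

omit h in
/-- `Z(s) = s · mellin (1_{(1,∞)} piErr) (−s)`. [cite: BrouckeDebruyneRevesz2023, proof of Theorem 3.2] -/
theorem Z_eq_mellin (s : ℂ) :
    Z R S δ M P s = s * mellin ((Ioi 1).indicator (piErr R S δ M P)) (-s) := by
  rw [Z, Hilberdink.mellin_indicator_Ioi_one]

/-- The Mellin kernel is locally integrable on `(0, ∞)` (bounded on bounded sets). [folklore] -/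
theorem Adm.locallyIntegrableOn_piErr : LocallyIntegrableOn ((Ioi 1).indicator (piErr R S δ M P)) (Ioi 0) := by
  rw [locallyIntegrableOn_iff isOpen_Ioi.isLocallyClosed]
  intro k _ hkc
  obtain ⟨X, hX⟩ := hkc.isBounded.bddAbove
  have hmeas : Measurable ((Ioi 1).indicator (piErr R S δ M P)) := (h.measurable_piErr P).indicator measurableSet_Ioi
  refine Integrable.mono' (g := fun _ ↦ P.riemannPrimeCount X + G R S δ M X) ?_ hmeas.aestronglyMeasurable ?_
  · have : IsFiniteMeasure (volume.restrict k) := ⟨by rw [Measure.restrict_apply_univ]; exact hkc.measure_lt_top⟩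
    exact integrable_const _
  · rw [ae_restrict_iff' hkc.measurableSet]
    refine Eventually.of_forall fun x hx ↦ ?_
    by_cases h1 : x ∈ Ioi (1 : ℝ)
    · rw [indicator_of_mem h1]; exact h.norm_piErr_le P (hX hx)
    · rw [indicator_of_notMem h1, norm_zero]
      exact add_nonneg (P.riemannPrimeCount_nonneg X) (h.G_nonneg X)

omit h in
/-- The Mellin kernel vanishes near `0⁺`. [folklore] -/
theorem piErr_isBigO_zero (b : ℝ) :
    (Ioi 1).indicator (piErr R S δ M P) =O[𝓝[>] 0] fun x : ℝ ↦ x ^ (-b) := by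
  have h1 : (Ioi 1).indicator (piErr R S δ M P) =ᶠ[𝓝[>] 0] fun _ ↦ (0 : ℂ) := by
    have : Ioo (0 : ℝ) 1 ∈ 𝓝[>] (0 : ℝ) := Ioo_mem_nhdsGT one_pos
    filter_upwards [this] with x hx
    rw [indicator_of_notMem (by simpa using hx.2.le)]
  exact (isBigO_zero _ _).congr' h1.symm EventuallyEq.rfl

/-- **`Π_P − G = O(x^ε)` for every `ε > 0`** under `|π_P − F| ≤ A'` (`log log x ≤ log x ≤ x^ε/ε`).
[cite: BrouckeDebruyneRevesz2023, proof of Theorem 3.2 (3.2)] -/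
theorem Adm.piErr_isBigO_top {A' : ℝ} (hπ : ∀ y : ℝ, 1 ≤ y → |(P.primeCount y : ℝ) - F R S δ M y| ≤ A')
    {ε : ℝ} (hε : 0 < ε) :
    (Ioi 1).indicator (piErr R S δ M P) =O[atTop] fun x : ℝ ↦ x ^ (-(-ε)) := by
  obtain ⟨C, hC0, hC⟩ := h.exists_abs_riemannPrimeCount_sub_G_le P hπ
  refine IsBigO.of_bound (C / ε) ?_
  filter_upwards [eventually_ge_atTop (3 : ℝ)] with x hx
  have hx0 : 0 < x := by linarith
  rw [indicator_of_mem (show x ∈ Ioi (1 : ℝ) by simp; linarith), neg_neg, piErr, Complex.norm_real,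
    Real.norm_eq_abs, Real.norm_eq_abs, abs_of_nonneg (Real.rpow_nonneg hx0.le _)]
  have hlx : 1 < Real.log x := by
    rw [Real.lt_log_iff_exp_lt hx0]; exact lt_of_lt_of_le (by have := Real.exp_one_lt_d9; linarith) hx
  have h1 : Real.log (Real.log x) ≤ Real.log x := (Real.log_le_sub_one_of_pos (by linarith)).trans (by linarith)
  have h2 : Real.log x ≤ x ^ ε / ε := Real.log_le_rpow_div hx0.le hε
  calc |P.riemannPrimeCount x - G R S δ M x| ≤ C * Real.log (Real.log x) := hC x hx
    _ ≤ C * (x ^ ε / ε) := mul_le_mul_of_nonneg_left (h1.trans h2) hC0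
    _ = C / ε * x ^ ε := by ring

/-- **`Z` is holomorphic on `Re s > 0`** ("`Z(s)` is analytic for `Re s > 0`").
[cite: BrouckeDebruyneRevesz2023, proof of Theorem 3.2] -/
theorem Adm.differentiableOn_Z {A' : ℝ} (hπ : ∀ y : ℝ, 1 ≤ y → |(P.primeCount y : ℝ) - F R S δ M y| ≤ A') :
    DifferentiableOn ℂ (Z R S δ M P) {s : ℂ | 0 < s.re} := by
  intro s hs
  simp only [mem_setOf_eq] at hs
  have hdiff : DifferentiableAt ℂ (mellin ((Ioi 1).indicator (piErr R S δ M P))) (-s) :=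
    mellin_differentiableAt_of_isBigO_rpow (h.locallyIntegrableOn_piErr P)
      (h.piErr_isBigO_top P hπ (half_pos hs)) (by simp only [neg_re]; linarith)
      (piErr_isBigO_zero P (-s.re - 1)) (by simp only [neg_re]; linarith)
  have hfun : Z R S δ M P = fun s ↦ s * mellin ((Ioi 1).indicator (piErr R S δ M P)) (-s) :=
    funext (Z_eq_mellin P)
  rw [hfun]
  exact (differentiableAt_id.mul (hdiff.comp s differentiableAt_id.neg)).differentiableWithinAt

omit h in
/-- **`Z(σ)` is real for real `σ`.** [cite: BrouckeDebruyneRevesz2023, proof of Theorem 3.2] -/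
theorem Z_ofReal (σ : ℝ) :
    Z R S δ M P σ = ((σ * ∫ x in Ioi (1 : ℝ), (P.riemannPrimeCount x - G R S δ M x) * x ^ (-σ - 1) : ℝ) : ℂ) := by
  rw [Z]
  push_cast
  congr 1
  rw [← integral_complex_ofReal]
  refine setIntegral_congr_fun measurableSet_Ioi fun x hx ↦ ?_
  have hx0 : 0 ≤ x := le_trans zero_le_one (le_of_lt hx)
  rw [piErr, Complex.ofReal_mul, Complex.ofReal_cpow hx0]
  push_cast
  ring_nf

omit h in
/-- `Im Z(σ) = 0` for real `σ`. [cite: BrouckeDebruyneRevesz2023, proof of Theorem 3.2] -/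
theorem Z_ofReal_im (σ : ℝ) : (Z R S δ M P σ).im = 0 := by
  rw [Z_ofReal, Complex.ofReal_im]

/-! ### `exp ∫₁^∞ g u^{−s} du = E(s)` and `∫₁^∞ g u^{−s} du = s ∫₁^∞ G x^{−s−1} dx` -/

/-- **`exp(∫₁^∞ g(u) u^{−s} du) = E(s)`** for `Re s > 1` (`ℳ{dLi(x^z); s} = log(s/(s − z))` termwise).
[cite: BrouckeDebruyneRevesz2023, proof of Theorem 3.2 ("`E(s) = exp(ℳ{dG;s})`")] -/
theorem Adm.exp_integral_g_cpow {s : ℂ} (hs : 1 < s.re) :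
    Complex.exp (∫ u in Ioi (1 : ℝ), (g R S δ M u : ℂ) * (u : ℂ) ^ (-s)) = E R S δ M s := by
  have hs0 : 0 < s.re := by linarith
  -- integrability of each `cpowDensity r · u^{-s}` for real `r < Re s`
  have hI : ∀ r : ℝ, r < s.re → IntegrableOn (fun u : ℝ ↦ cpowDensity (r : ℂ) u * (u : ℂ) ^ (-s)) (Ioi 1) :=
    fun r hr ↦ (integral_cpowDensity_mul_cpow hs0 (by simpa using hr)).1
  have hexp : ∀ r : ℝ, r < s.re →
      Complex.exp (∫ u in Ioi (1 : ℝ), cpowDensity (r : ℂ) u * (u : ℂ) ^ (-s)) = s / (s - r) :=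
    fun r hr ↦ exp_integral_cpowDensity_mul_cpow hs0 (by simpa using hr)
  have hS' : ∀ ω ∈ S, ω < s.re := fun ω hω ↦ by linarith [(h.hS ω hω).2]
  have hR' : ∀ ρ ∈ R, ρ < s.re := fun ρ hρ ↦ by linarith [(h.hR ρ hρ).2]
  have hδ' : δ < s.re := by linarith [h.hδ1]
  have h1' : (1 : ℝ) < s.re := hs
  -- rewrite the integrand
  have hcongr : ∫ u in Ioi (1 : ℝ), (g R S δ M u : ℂ) * (u : ℂ) ^ (-s) =
      ∫ u in Ioi (1 : ℝ), (cpowDensity ((1 : ℝ) : ℂ) u * (u : ℂ) ^ (-s) +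
        ∑ ω ∈ S, cpowDensity (ω : ℂ) u * (u : ℂ) ^ (-s) - ∑ ρ ∈ R, cpowDensity (ρ : ℂ) u * (u : ℂ) ^ (-s) +
        (M : ℂ) * (cpowDensity (δ : ℂ) u * (u : ℂ) ^ (-s))) := by
    refine setIntegral_congr_fun measurableSet_Ioi fun u hu ↦ ?_
    rw [g_eq_cpowDensity hu]
    simp only [add_mul, sub_mul, Finset.sum_mul]
    ring
  have hIS : IntegrableOn (fun u : ℝ ↦ ∑ ω ∈ S, cpowDensity (ω : ℂ) u * (u : ℂ) ^ (-s)) (Ioi 1) :=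
    MeasureTheory.integrable_finsetSum S fun ω hω ↦ hI ω (hS' ω hω)
  have hIR : IntegrableOn (fun u : ℝ ↦ ∑ ρ ∈ R, cpowDensity (ρ : ℂ) u * (u : ℂ) ^ (-s)) (Ioi 1) :=
    MeasureTheory.integrable_finsetSum R fun ρ hρ ↦ hI ρ (hR' ρ hρ)
  have hIδ : IntegrableOn (fun u : ℝ ↦ (M : ℂ) * (cpowDensity (δ : ℂ) u * (u : ℂ) ^ (-s))) (Ioi 1) :=
    (hI δ hδ').const_mul _
  have hI12 : IntegrableOn (fun u : ℝ ↦ cpowDensity ((1 : ℝ) : ℂ) u * (u : ℂ) ^ (-s) +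
      ∑ ω ∈ S, cpowDensity (ω : ℂ) u * (u : ℂ) ^ (-s)) (Ioi 1) := (hI 1 h1').add hIS
  have hI123 : IntegrableOn (fun u : ℝ ↦ cpowDensity ((1 : ℝ) : ℂ) u * (u : ℂ) ^ (-s) +
      ∑ ω ∈ S, cpowDensity (ω : ℂ) u * (u : ℂ) ^ (-s) - ∑ ρ ∈ R, cpowDensity (ρ : ℂ) u * (u : ℂ) ^ (-s)) (Ioi 1) :=
    hI12.sub hIR
  rw [hcongr, integral_add hI123 hIδ, integral_sub hI12 hIR, integral_add (hI 1 h1') hIS,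
    integral_finsetSum S fun ω hω ↦ hI ω (hS' ω hω),
    integral_finsetSum R fun ρ hρ ↦ hI ρ (hR' ρ hρ), MeasureTheory.integral_const_mul]
  rw [Complex.exp_add, Complex.exp_sub, Complex.exp_add, Complex.exp_sum, Complex.exp_sum, Complex.exp_nat_mul,
    hexp 1 h1', hexp δ hδ', Finset.prod_congr rfl fun ω hω ↦ hexp ω (hS' ω hω),
    Finset.prod_congr rfl fun ρ hρ ↦ hexp ρ (hR' ρ hρ)]
  unfold E
  push_cast
  have hprod : ∏ ρ ∈ R, ((s - ρ) / s) = (∏ ρ ∈ R, (s / (s - ρ)))⁻¹ := by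
    rw [← Finset.prod_inv_distrib]
    exact Finset.prod_congr rfl fun ρ _ ↦ by rw [inv_div]
  rw [hprod, div_eq_mul_inv]

omit h in
/-- Integrability of `u ↦ q(u) u^{r}` on `(1, ∞)` for a measurable `q` with `‖q u‖ ≤ B u^a` and `a + Re r < −1`
(the dominations `‖q‖ ≤ B`, `‖q‖ ≤ B u` used below). [folklore] -/
theorem integrableOn_mul_cpow_of_norm_le {q : ℝ → ℂ} (hq : Measurable q) {B a : ℝ} {r : ℂ}
    (hb : ∀ u, 1 < u → ‖q u‖ ≤ B * u ^ a) (hr : a + r.re < -1) :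
    IntegrableOn (fun u : ℝ ↦ q u * (u : ℂ) ^ r) (Ioi 1) := by
  have hmeas : AEStronglyMeasurable (fun u : ℝ ↦ q u * (u : ℂ) ^ r) (volume.restrict (Ioi 1)) :=
    (hq.mul ((Complex.measurable_ofReal.comp measurable_id).pow_const _)).aestronglyMeasurable
  refine Integrable.mono' (((integrableOn_Ioi_rpow_of_lt hr one_pos)).const_mul B) hmeas ?_
  rw [ae_restrict_iff' measurableSet_Ioi]
  refine Eventually.of_forall fun u hu ↦ ?_
  have hu1 : (1 : ℝ) < u := hu
  have hu0 : 0 < u := lt_trans one_pos hu1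
  rw [norm_mul, norm_cpow_eq_rpow_re_of_pos hu0, Real.rpow_add hu0, ← mul_assoc]
  exact mul_le_mul_of_nonneg_right (hb u hu1) (Real.rpow_pos_of_pos hu0 _).le

/-- **`∫₁^∞ g(u) u^{−s} du = s ∫₁^∞ G(x) x^{−s−1} dx`** for `Re s > 1` (integration by parts on `[1, ∞)`,
`G(1) = 0`, `G(x) x^{−s} → 0`), with the integrability of both integrands.
[cite: BrouckeDebruyneRevesz2023, proof of Theorem 3.2 (`ℳ{dG; s}`)] -/
theorem Adm.integral_g_cpow_eq {s : ℂ} (hs : 1 < s.re) :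
    IntegrableOn (fun u : ℝ ↦ (g R S δ M u : ℂ) * (u : ℂ) ^ (-s)) (Ioi 1) ∧
    IntegrableOn (fun x : ℝ ↦ (G R S δ M x : ℂ) * (x : ℂ) ^ (-s - 1)) (Ioi 1) ∧
      ∫ u in Ioi (1 : ℝ), (g R S δ M u : ℂ) * (u : ℂ) ^ (-s) =
        s * ∫ x in Ioi (1 : ℝ), (G R S δ M x : ℂ) * (x : ℂ) ^ (-s - 1) := by
  have hW := wBound_pos (R := R) (S := S) (M := M)
  have hs0 : s ≠ 0 := fun h0 ↦ by rw [h0] at hs; simp at hs; linarith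
  -- integrability
  have hgI : IntegrableOn (fun u : ℝ ↦ (g R S δ M u : ℂ) * (u : ℂ) ^ (-s)) (Ioi 1) := by
    refine integrableOn_mul_cpow_of_norm_le (q := fun u ↦ (g R S δ M u : ℂ)) (Complex.measurable_ofReal.comp h.measurable_g)
      (B := wBound R S M) (a := 0) (fun u _ ↦ ?_) (by simp; linarith)
    rw [Real.rpow_zero, mul_one, Complex.norm_real, Real.norm_eq_abs, abs_of_nonneg (h.g_nonneg u)]
    exact h.g_le_wBound u
  have hGb : ∀ u : ℝ, 1 < u → ‖(G R S δ M u : ℂ)‖ ≤ wBound R S M * u ^ (1 : ℝ) := by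
    intro u hu
    rw [Complex.norm_real, Real.norm_eq_abs, abs_of_nonneg (h.G_nonneg u), Real.rpow_one]
    exact (h.G_le_sub_one hu.le).trans (by nlinarith)
  have hGI : IntegrableOn (fun x : ℝ ↦ (G R S δ M x : ℂ) * (x : ℂ) ^ (-s - 1)) (Ioi 1) :=
    integrableOn_mul_cpow_of_norm_le (q := fun x ↦ (G R S δ M x : ℂ))
      (Complex.measurable_ofReal.comp h.continuous_G.measurable) hGb (by simp; linarith)
  have hGI' : IntegrableOn (fun x : ℝ ↦ (G R S δ M x : ℂ) * (-s * (x : ℂ) ^ (-s - 1))) (Ioi 1) :=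
    (hGI.const_mul (-s)).congr (ae_of_all _ fun x ↦ by simp only; ring)
  refine ⟨hgI, hGI, ?_⟩
  -- integration by parts via `integral_Ioi_of_hasDerivAt_of_tendsto`
  set Φ : ℝ → ℂ := fun u ↦ (G R S δ M u : ℂ) * (u : ℂ) ^ (-s) with hΦ
  have hderiv : ∀ u ∈ Ioi (1 : ℝ), HasDerivAt Φ
      ((g R S δ M u : ℂ) * (u : ℂ) ^ (-s) + (G R S δ M u : ℂ) * (-s * (u : ℂ) ^ (-s - 1))) u := by
    intro u hu
    have hu1 : (1 : ℝ) < u := hu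
    have h1 := (h.hasDerivAt_G hu1).ofReal_comp
    have h2 : HasDerivAt (fun y : ℝ ↦ (y : ℂ) ^ (-s)) (-s * (u : ℂ) ^ (-s - 1)) u :=
      hasDerivAt_ofReal_cpow_const (by linarith) (neg_ne_zero.mpr hs0)
    exact h1.mul h2
  have hcont : ContinuousWithinAt Φ (Ici 1) 1 := by
    refine ContinuousAt.continuousWithinAt ?_
    refine (Complex.continuous_ofReal.comp h.continuous_G).continuousAt.mul ?_
    exact (Complex.continuous_ofReal.continuousAt).cpow continuousAt_const (Or.inl (by simp))
  have htend : Tendsto Φ atTop (𝓝 0) := by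
    refine squeeze_zero_norm' (a := fun u : ℝ ↦ wBound R S M * u ^ (1 - s.re)) ?_ ?_
    · filter_upwards [eventually_gt_atTop (1 : ℝ)] with u hu
      have hu0 : 0 < u := by linarith
      rw [hΦ, norm_mul, norm_cpow_eq_rpow_re_of_pos hu0, neg_re, show (1 - s.re : ℝ) = 1 + -s.re by ring,
        Real.rpow_add hu0]
      calc ‖(G R S δ M u : ℂ)‖ * u ^ (-s.re) ≤ wBound R S M * u ^ (1 : ℝ) * u ^ (-s.re) :=
            mul_le_mul_of_nonneg_right (hGb u hu) (Real.rpow_pos_of_pos hu0 _).le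
        _ = wBound R S M * (u ^ (1 : ℝ) * u ^ (-s.re)) := by ring
    · have := (tendsto_rpow_neg_atTop (show 0 < s.re - 1 by linarith)).const_mul (wBound R S M)
      rw [mul_zero] at this
      refine this.congr fun u ↦ ?_
      congr 1; ring_nf
  have hparts := integral_Ioi_of_hasDerivAt_of_tendsto hcont hderiv (hgI.add hGI') htend
  rw [integral_add hgI hGI', hΦ] at hparts
  simp only [G_one, Complex.ofReal_zero, zero_mul, sub_zero] at hparts
  have hI2 : ∫ x in Ioi (1 : ℝ), (G R S δ M x : ℂ) * (-s * (x : ℂ) ^ (-s - 1)) =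
      -s * ∫ x in Ioi (1 : ℝ), (G R S δ M x : ℂ) * (x : ℂ) ^ (-s - 1) := by
    rw [← MeasureTheory.integral_const_mul]
    exact integral_congr_ae (Eventually.of_forall fun x ↦ by ring)
  rw [hI2] at hparts
  linear_combination hparts

/-! ### `ζ_P(s) = E(s) e^{Z(s)}` for `Re s > 1` -/

/-- Under (1.3), `Σ_j λ_j^{−σ} < ∞` for `σ > 1` (through the truncated density and the tree's `BV` bound).
[cite: BrouckeVindas2024, Theorem 1.2] -/
theorem Adm.summable_prime_rpow_neg {A : ℝ} (hA : BV.Approx (f R S δ M) P A) {σ : ℝ} (hσ : 1 < σ) :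
    Summable fun j ↦ P.prime j ^ (-σ) :=
  (h.approx_fT hA).summable_prime_rpow_neg h.abs_fT_le_two hσ

/-- `Π_P(x) ≤ B x` on `[1, ∞)` under `|π_P − F| ≤ A'` (`Π_P ≤ G + O(log x)`, `G ≤ W(x−1)`). [folklore] -/
theorem Adm.exists_riemannPrimeCount_le {A' : ℝ} (hπ : ∀ y : ℝ, 1 ≤ y → |(P.primeCount y : ℝ) - F R S δ M y| ≤ A') :
    ∃ B : ℝ, 0 ≤ B ∧ ∀ x : ℝ, 1 ≤ x → P.riemannPrimeCount x ≤ B * x := by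
  obtain ⟨C, hC0, hC⟩ := h.exists_abs_riemannPrimeCount_sub_G_le P hπ
  set E₀ : ℝ := P.riemannPrimeCount 3 + G R S δ M 3
  have hE₀ : 0 ≤ E₀ := add_nonneg (P.riemannPrimeCount_nonneg 3) (h.G_nonneg 3)
  have hW := wBound_pos (R := R) (S := S) (M := M)
  refine ⟨wBound R S M + E₀ + C, by positivity, fun x hx ↦ ?_⟩
  have h1 := h.abs_riemannPrimeCount_sub_G_le_unif P hC0 hC hx le_rfl
  have h2 := h.G_le_sub_one hx
  have h3 : Real.log x ≤ x := (Real.log_le_sub_one_of_pos (by linarith)).trans (by linarith)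
  have h4 : P.riemannPrimeCount x ≤ G R S δ M x + (E₀ + C * Real.log x) := by linarith [(abs_le.mp h1).2]
  nlinarith [mul_le_mul_of_nonneg_left h3 hC0]

/-- **`s ∫₁^∞ Π_P(x) x^{−s−1} dx = Σ_j λ_j^{−s} + E₁(s)`** for `Re s > 1`, together with the integrability of the
integrand: `ℳ{dΠ_𝒫; s} = Σ_j log((1 − λ_j^{−s})⁻¹)` (tree `LogZetaMellin`) `= Σ_j λ_j^{−s} + E₁` (tree `BV`).
[cite: BrouckeDebruyneRevesz2023, proof of Theorem 3.2 ("`log ζ_𝒫(s) = … = ℳ{dΠ_𝒫; s}`")] -/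
theorem Adm.mul_integral_riemannPrimeCount_eq {A A' : ℝ} (hA : BV.Approx (f R S δ M) P A)
    (hπ : ∀ y : ℝ, 1 ≤ y → |(P.primeCount y : ℝ) - F R S δ M y| ≤ A') {s : ℂ} (hs : 1 < s.re) :
    IntegrableOn (fun x : ℝ ↦ ((P.riemannPrimeCount x : ℝ) : ℂ) * (x : ℂ) ^ (-s - 1)) (Ioi 1) ∧
    s * ∫ x in Ioi (1 : ℝ), ((P.riemannPrimeCount x : ℝ) : ℂ) * (x : ℂ) ^ (-s - 1) =
      (∑' j, ((P.prime j : ℝ) : ℂ) ^ (-s)) + DMV.Template.E₁ P s := by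
  have hs0 : 0 < s.re := by linarith
  have hsum := h.summable_prime_rpow_neg P hA hs
  refine ⟨?_, ?_⟩
  · obtain ⟨B, hB0, hB⟩ := h.exists_riemannPrimeCount_le P hπ
    refine integrableOn_mul_cpow_of_norm_le (q := fun x ↦ ((P.riemannPrimeCount x : ℝ) : ℂ))
      (Complex.measurable_ofReal.comp P.measurable_riemannPrimeCount) (B := B) (a := 1) (fun x hx ↦ ?_)
      (by simp; linarith)
    rw [Complex.norm_real, Real.norm_eq_abs, abs_of_nonneg (P.riemannPrimeCount_nonneg x), Real.rpow_one]
    exact hB x hx.le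
  rw [P.mul_integral_riemannPrimeCount_eq_tsum hs0 hsum,
    ← (h.approx_fT hA).tsum_log_eulerFactor_eq h.abs_fT_le_two hs]
  -- `Σ_{(j,k)} = Σ_j Σ_k` by absolute convergence, then Mercator
  set F : ℕ × ℕ → ℂ := fun jk ↦
    (((1 / ((jk.2 : ℝ) + 1) : ℝ)) : ℂ) * (((P.prime jk.1 ^ (jk.2 + 1) : ℝ)) : ℂ) ^ (-s) with hF
  have hnorm : ∀ jk, ‖F jk‖ = 1 / ((jk.2 : ℝ) + 1) * (P.prime jk.1 ^ (jk.2 + 1)) ^ (-s.re) := by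
    intro jk
    rw [hF]
    simp only [norm_mul, Complex.norm_real, Real.norm_eq_abs]
    rw [abs_of_nonneg (by positivity), norm_cpow_eq_rpow_re_of_pos (pow_pos (P.prime_pos jk.1) _), neg_re]
  have hFs : Summable F := by
    refine Summable.of_norm ?_
    simp_rw [hnorm]
    exact summable_primePow_weight P hs0 hsum
  rw [hFs.tsum_prod' (fun j ↦ hFs.comp_injective (Prod.mk_right_injective j))]
  refine tsum_congr fun j ↦ ?_
  exact (P.log_eulerFactor_hasSum hs0 j).tsum_eq

/-- **`ζ_P(s) = E(s) e^{Z(s)}` for `Re s > 1`.** [cite: BrouckeDebruyneRevesz2023, Theorem 3.2 ("`ζ_𝒫(s) = E(s)e^{Z(s)}`")] -/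
theorem Adm.zeta_eq_E_mul_exp_Z {A A' : ℝ} (hA : BV.Approx (f R S δ M) P A)
    (hπ : ∀ y : ℝ, 1 ≤ y → |(P.primeCount y : ℝ) - F R S δ M y| ≤ A') {s : ℂ} (hs : 1 < s.re) :
    P.zeta s = E R S δ M s * Complex.exp (Z R S δ M P s) := by
  have hs0 : 0 < s.re := by linarith
  have hsum := h.summable_prime_rpow_neg P hA hs
  obtain ⟨hPiI, hPi⟩ := h.mul_integral_riemannPrimeCount_eq P hA hπ hs
  obtain ⟨-, hGI, hG⟩ := h.integral_g_cpow_eq hs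
  -- `Z s = s∫Π x^{-s-1} − ∫ g u^{-s}`
  have hZ : Z R S δ M P s = s * (∫ x in Ioi (1 : ℝ), ((P.riemannPrimeCount x : ℝ) : ℂ) * (x : ℂ) ^ (-s - 1)) -
      ∫ u in Ioi (1 : ℝ), (g R S δ M u : ℂ) * (u : ℂ) ^ (-s) := by
    rw [hG, ← mul_sub, ← integral_sub hPiI hGI, Z]
    congr 1
    refine setIntegral_congr_fun measurableSet_Ioi fun x _ ↦ ?_
    simp only [piErr]; push_cast; ring
  rw [P.zeta_eq_exp_mul_integral_riemannPrimeCount hs0 hsum, hZ, Complex.exp_sub, ← h.exp_integral_g_cpow hs]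
  field_simp


/-! ### `Z` versus the Broucke–Vindas continuation `BV.Z fT g P` -/

/-- The constant of (1.3) for the truncated density: `Ã = A + W(u₀ − 1)`. [cite: BrouckeDebruyneRevesz2023, proof of Theorem 3.2] -/
def apxT (R S : Finset ℝ) (M : ℕ) (A : ℝ) : ℝ := A + wBound R S M * (cutoff R S M - 1)

/-- On `Re s > 1`, `Z(s) = (Σ_j λ_j^{−s} + E₁(s)) − ∫₁^∞ g(u) u^{−s} du`. [cite: BrouckeDebruyneRevesz2023, proof of Theorem 3.2] -/
theorem Adm.Z_eq_of_one_lt {A A' : ℝ} (hA : BV.Approx (f R S δ M) P A)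
    (hπ : ∀ y : ℝ, 1 ≤ y → |(P.primeCount y : ℝ) - F R S δ M y| ≤ A') {s : ℂ} (hs : 1 < s.re) :
    Z R S δ M P s = ((∑' j, ((P.prime j : ℝ) : ℂ) ^ (-s)) + DMV.Template.E₁ P s) -
      ∫ u in Ioi (1 : ℝ), (g R S δ M u : ℂ) * (u : ℂ) ^ (-s) := by
  obtain ⟨hPiI, hPi⟩ := h.mul_integral_riemannPrimeCount_eq P hA hπ hs
  obtain ⟨-, hGI, hG⟩ := h.integral_g_cpow_eq hs
  rw [← hPi, hG, ← mul_sub, ← integral_sub hPiI hGI, Z]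
  congr 1
  refine setIntegral_congr_fun measurableSet_Ioi fun x _ ↦ ?_
  simp only [piErr]; push_cast; ring

/-- On `Re s > 1`, the tree's `BV.Z fT g P` (for the truncated density `fT` and the constant `Ã`) equals `Z`:
`E₁ + (Σ_j λ_j^{−s} − ∫ fT u^{−s}) − ∫ (g − fT) u^{−s} = Σ_j λ_j^{−s} + E₁ − ∫ g u^{−s}`.
[cite: BrouckeDebruyneRevesz2023, proof of Theorem 3.2 (decomposition of `Z`)] -/
theorem Adm.bvZ_eq_Z_of_one_lt {A A' : ℝ} (hA : BV.Approx (f R S δ M) P A)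
    (hπ : ∀ y : ℝ, 1 ≤ y → |(P.primeCount y : ℝ) - F R S δ M y| ≤ A') {s : ℂ} (hs : 1 < s.re) :
    BV.Z (fT R S δ M) (g R S δ M) P s = Z R S δ M P s := by
  have hAT := h.approx_fT hA
  rw [BV.Z, BV.E₂_eq hAT h.measurable_fT h.abs_fT_le_two hs,
    (BV.integral_f_cpow_eq h.measurable_fT h.abs_fT_le_two h.measurable_g h.g_sub_fT_mem hs).2,
    h.Z_eq_of_one_lt P hA hπ hs]
  ring

/-- **`Z = BV.Z fT g P` on `Re s > 1/2`** (both are holomorphic there and agree on `Re s > 1`; identity theorem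
on the convex half-plane). [cite: BrouckeDebruyneRevesz2023, proof of Theorem 3.2] -/
theorem Adm.Z_eq_bvZ {A A' : ℝ} (hA : BV.Approx (f R S δ M) P A)
    (hπ : ∀ y : ℝ, 1 ≤ y → |(P.primeCount y : ℝ) - F R S δ M y| ≤ A') {s : ℂ} (hs : 1 / 2 < s.re) :
    Z R S δ M P s = BV.Z (fT R S δ M) (g R S δ M) P s := by
  set U : Set ℂ := {w : ℂ | 1 / 2 < w.re} with hU
  have hUo : IsOpen U := isOpen_lt continuous_const Complex.continuous_re
  have hZd : DifferentiableOn ℂ (Z R S δ M P) U :=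
    (h.differentiableOn_Z P hπ).mono fun w hw ↦ by
      simp only [hU, mem_setOf_eq] at hw ⊢; linarith
  have hBd : DifferentiableOn ℂ (BV.Z (fT R S δ M) (g R S δ M) P) U :=
    BV.differentiableOn_Z (h.approx_fT hA) h.measurable_fT h.abs_fT_le_two h.measurable_g h.g_sub_fT_mem
  have hev : Z R S δ M P =ᶠ[𝓝 (2 : ℂ)] BV.Z (fT R S δ M) (g R S δ M) P := by
    have : {w : ℂ | 1 < w.re} ∈ 𝓝 (2 : ℂ) := (isOpen_lt continuous_const Complex.continuous_re).mem_nhds (by simp)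
    filter_upwards [this] with w hw using (h.bvZ_eq_Z_of_one_lt P hA hπ hw).symm
  have heq : EqOn (Z R S δ M P) (BV.Z (fT R S δ M) (g R S δ M) P) U :=
    (hZd.analyticOnNhd hUo).eqOn_of_preconnected_of_eventuallyEq (hBd.analyticOnNhd hUo)
      (convex_halfSpace_re_gt (1 / 2)).isPreconnected (by rw [hU]; show (1 : ℝ) / 2 < (2 : ℂ).re; norm_num) hev
  exact heq (by simpa [hU] using hs)

/-! ### The bound (3.4) -/

/-- **(3.4) on `1/2 < σ ≤ 2`** in the tree's `BV` form: `‖Z(s)‖ ≤ C_Z (1/(σ−1/2) + √log(|t|+1)/√(σ−1/2))`,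
`C_Z = BV.CZ P Ã K` with `Ã = apxT`, `K = cmpK`. [cite: BrouckeDebruyneRevesz2023, Theorem 3.2 (3.4)] -/
theorem Adm.norm_Z_le_of_le_two {A A' : ℝ} (hA : BV.Approx (f R S δ M) P A)
    (hπ : ∀ y : ℝ, 1 ≤ y → |(P.primeCount y : ℝ) - F R S δ M y| ≤ A') {s : ℂ} (hs : 1 / 2 < s.re)
    (hs2 : s.re ≤ 2) :
    ‖Z R S δ M P s‖ ≤ BV.CZ P (apxT R S M A) (cmpK R S M) *
      (1 / (s.re - 1 / 2) + Real.sqrt (Real.log (|s.im| + 1)) / Real.sqrt (s.re - 1 / 2)) := by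
  rw [h.Z_eq_bvZ P hA hπ hs]
  exact BV.norm_Z_le (h.approx_fT hA) h.measurable_fT h.abs_fT_le_two h.measurable_g h.g_sub_fT_mem hs hs2

/-- The prime-power tail on `σ ≥ 2`: `‖E₁(s)‖ ≤ K₀ Σ_j λ_j^{−4}` (uniformly). [cite: BrouckeVindas2024, proof of Theorem 3.1] -/
theorem Adm.norm_E₁_le_of_two_le {A : ℝ} (hA : BV.Approx (f R S δ M) P A) {s : ℂ} (hs : 2 ≤ s.re) :
    ‖DMV.Template.E₁ P s‖ ≤ (∑' j, P.prime j ^ (-(4 : ℝ))) * ((1 - P.prime 0 ^ (-(1 / 2 : ℝ)))⁻¹ / 2) := by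
  have hsum := h.summable_prime_rpow_neg P hA (by norm_num : (1 : ℝ) < 4)
  unfold DMV.Template.E₁
  rw [← tsum_mul_right]
  refine tsum_of_norm_bounded (hsum.mul_right _).hasSum fun j ↦ ?_
  have h1 := DMV.Template.norm_E₁term_le_of_le P j (by norm_num : (0 : ℝ) < 3 / 2) (s := s) (by linarith)
  norm_num at h1 ⊢
  exact h1

/-- **The bound (3.4)** in the printed shape: there is `K ≥ 0` with
`‖Z(σ + it)‖ ≤ K (σ/(σ − 1/2) + σ √(log(|t|+1)/(σ − 1/2)))` for all `σ > 1/2` — BV's (3.2) on `σ ≤ 2` (where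
`1 ≤ 2σ`), and on `σ ≥ 2` the three pieces `E₁ = O(1)`, `‖E₂‖ ≤ σÃ(1/(σ−1/2) + √π√(log(|t|+1)/(σ−1/2)))`,
`‖E₃‖ ≤ K̃/(σ−1/2)`. [cite: BrouckeDebruyneRevesz2023, Theorem 3.2 (3.4)] -/
theorem Adm.norm_Z_le {A A' : ℝ} (hA : BV.Approx (f R S δ M) P A)
    (hπ : ∀ y : ℝ, 1 ≤ y → |(P.primeCount y : ℝ) - F R S δ M y| ≤ A') :
    ∃ K : ℝ, 0 ≤ K ∧ ∀ s : ℂ, 1 / 2 < s.re → ‖Z R S δ M P s‖ ≤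
      K * (s.re / (s.re - 1 / 2) + s.re * Real.sqrt (Real.log (|s.im| + 1) / (s.re - 1 / 2))) := by
  set At : ℝ := apxT R S M A with hAt
  set Kt : ℝ := cmpK R S M with hKt
  have hAT : BV.Approx (fT R S δ M) P At := h.approx_fT hA
  set K₁ : ℝ := (∑' j, P.prime j ^ (-(4 : ℝ))) * ((1 - P.prime 0 ^ (-(1 / 2 : ℝ)))⁻¹ / 2) with hK₁
  have hAt0 : 0 ≤ At := hAT.nonneg
  have hKt0 : 0 ≤ Kt := BV.cmpConst_nonneg h.g_sub_fT_mem
  have hK₀ := BV.E₁const_nonneg P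
  have hK₁0 : 0 ≤ K₁ := mul_nonneg (tsum_nonneg fun j ↦ Real.rpow_nonneg (P.prime_pos j).le _) hK₀
  have hCZ0 : 0 ≤ BV.CZ P At Kt := by unfold BV.CZ; positivity
  refine ⟨2 * BV.CZ P At Kt + (K₁ + At + Kt + At * Real.sqrt π), by positivity, fun s hs ↦ ?_⟩
  set σ := s.re with hσ
  have hε : 0 < σ - 1 / 2 := by linarith
  set r : ℝ := 1 / (σ - 1 / 2) with hr
  set L : ℝ := Real.sqrt (Real.log (|s.im| + 1)) with hL
  set q : ℝ := Real.sqrt (Real.log (|s.im| + 1) / (σ - 1 / 2)) with hq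
  have hr0 : 0 < r := by positivity
  have hL0 : 0 ≤ L := Real.sqrt_nonneg _
  have hq0 : 0 ≤ q := Real.sqrt_nonneg _
  have hqL : L / Real.sqrt (σ - 1 / 2) = q := by
    rw [hq, hL, Real.sqrt_div' _ hε.le]
  have hσr : σ / (σ - 1 / 2) = σ * r := by rw [hr]; field_simp
  have hσr1 : 1 ≤ σ * r := by rw [← hσr, le_div_iff₀ hε]; linarith
  rw [hσr]
  rcases le_or_gt σ 2 with hσ2 | hσ2
  · -- `σ ≤ 2`
    have h1 := h.norm_Z_le_of_le_two P hA hπ hs hσ2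
    rw [hqL] at h1
    have h2 : r + q ≤ 2 * (σ * r + σ * q) := by nlinarith
    calc ‖Z R S δ M P s‖ ≤ BV.CZ P At Kt * (r + q) := h1
      _ ≤ BV.CZ P At Kt * (2 * (σ * r + σ * q)) := mul_le_mul_of_nonneg_left h2 hCZ0
      _ = 2 * BV.CZ P At Kt * (σ * r + σ * q) := by ring
      _ ≤ (2 * BV.CZ P At Kt + (K₁ + At + Kt + At * Real.sqrt π)) * (σ * r + σ * q) := by
          have : 0 ≤ (K₁ + At + Kt + At * Real.sqrt π) * (σ * r + σ * q) := by positivity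
          nlinarith
  · -- `σ > 2`: the three pieces
    rw [h.Z_eq_bvZ P hA hπ hs, BV.Z]
    have h1 : ‖DMV.Template.E₁ P s‖ ≤ K₁ := h.norm_E₁_le_of_two_le P hA hσ2.le
    have h2 := BV.norm_E₂_le hAT h.measurable_fT h.abs_fT_le_two hs
    have h3 := BV.norm_E₃_le h.measurable_fT h.measurable_g h.g_sub_fT_mem hs
    rw [← hσ] at h2 h3
    have h2' : ‖BV.E₂ (fT R S δ M) P s‖ ≤ At * (σ * r) + At * Real.sqrt π * (σ * q) := by
      refine h2.trans (le_of_eq ?_)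
      rw [← hqL, hr]; ring
    have h3' : ‖BV.E₃ (fT R S δ M) (g R S δ M) s‖ ≤ Kt * (σ * r) := by
      refine h3.trans ?_
      rw [div_eq_mul_one_div, ← hr]
      nlinarith [mul_le_mul_of_nonneg_left hσr1 hKt0]
    have h1' : ‖DMV.Template.E₁ P s‖ ≤ K₁ * (σ * r) := h1.trans (by nlinarith)
    calc ‖DMV.Template.E₁ P s + BV.E₂ (fT R S δ M) P s - BV.E₃ (fT R S δ M) (g R S δ M) s‖
        ≤ ‖DMV.Template.E₁ P s‖ + ‖BV.E₂ (fT R S δ M) P s‖ + ‖BV.E₃ (fT R S δ M) (g R S δ M) s‖ :=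
          (norm_sub_le _ _).trans (add_le_add (norm_add_le _ _) le_rfl)
      _ ≤ K₁ * (σ * r) + (At * (σ * r) + At * Real.sqrt π * (σ * q)) + Kt * (σ * r) :=
          add_le_add (add_le_add h1' h2') h3'
      _ ≤ (2 * BV.CZ P At Kt + (K₁ + At + Kt + At * Real.sqrt π)) * (σ * r + σ * q) := by
          have hσq : 0 ≤ σ * q := by nlinarith
          have hσr0 : 0 ≤ σ * r := by linarith
          nlinarith [mul_nonneg hCZ0 hσr0, mul_nonneg hCZ0 hσq, mul_nonneg hK₁0 hσq, mul_nonneg hAt0 hσq,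
            mul_nonneg hKt0 hσq, mul_nonneg (mul_nonneg hAt0 (Real.sqrt_nonneg π)) hσr0]

end BDR

end Literature.NumberTheory.BeurlingPrimes
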